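import Summits.BirchSwinnertonDyer.BirchSwinnertonDyer.Theorems.PrintX10bKatoLambdaMatch
import Summits.BirchSwinnertonDyer.BirchSwinnertonDyer.Theorems.PrintX9KatoEulerHalf
import Summits.BirchSwinnertonDyer.Rank1Residual.X9.SurjKatoCertificateRoute
import HarnessLib

/-!
# OFFER-X9-KATO-EULER record shapes: the p3 doors CLASS-FREE and IMAGE-FREE (good ordinary `p ≥ 5`,
# `E[p]` irreducible — surjective OR not), read off a literal integer model with kernel-decided
# reduction / ordinarity / irreducibility (print cell `bsd-print-x9`, seat p3; theorems only, nothing booked)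

The doors of `Theorems/PrintX9KatoEulerHalf.lean` / `PrintX9KatoLambdaMatch.lean` carry `ClassX9 W p`
(non-CM, `5 ≤ p`, good ordinary, `E[p]` irreducible, `ρ̄` NOT surjective) but USE only `5 ≤ p`, good,
ordinary, irreducible: the `μ = 0` step is the image-free node `Rank1Residual.KatoMuTransfer` (item 19629),
a theorem modulo F1 for EVERY irreducible image (surjective image: Kato 17.4 (3) = F1's `integral`
clause under `p`-adic surjectivity, `hasSurjectiveModNGaloisRep_pow_of_surj`, and principality of `char_Λ X`;
non-surjective: the X10/X9 kernel core `X10.mu_eq_zero_of_fine`) — re-derived here WITHOUT importing the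
route cone (`lint.theses-cone`). For the referee's per-pair
recount (director 13:08:48Z (2); plan `OFFER-X9-KATO-EULER-v0.md`) a RECORD must not depend on an image
certificate (ty3 schema: `imageCert = none` ⇒ image uncertified in-kernel). This file therefore states:

§1 the three doors CLASS-FREE (`IrrOrd.*`: hypotheses `5 ≤ p`, `W.HasGoodReductionAtPrime p`,
`¬ p ∣ a_p`, `W.HasIrreducibleModPGaloisRep p` — any image, CM or not):
`IrrOrd.bsdp_of_fine_of_unitCoeff_of_shaAn_unit` (D1: both ranks, `p ∤ #Ш_an`, unit coefficient,
Schneider certificate at rank 1), `IrrOrd.bsdp_of_fine_of_norm_constantCoeff_eq_one` (D2: rank-0 unit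
cell, ONE datum `‖L_p(f,α)(0)‖ = 1`), `IrrOrd.bsdp_rankOne_of_fine_of_norm_coeff_one_eq_one` (D3: rank 1,
ONE datum `‖[T¹]L_p(f,α)‖ = 1`);
§2 the RECORD shapes `Record.*_of_ainvs_*`: the same three with good reduction, ordinarity and
irreducibility DECIDED from a literal model `integralModelInt W = [a₁,a₂,a₃,a₄,a₆]`: `p ∤ Δ`, the
schema count `countPoints [a₁,…,a₆] p = n_p` with `p ∤ p + 1 − n_p` (`a_p = p + 1 − n_p`), and a
Frobenius witness `ℓ ≠ 2, p`, `ℓ ∤ Δ`, `countPoints [a₁,…,a₆] ℓ = n` with `X² − (ℓ+1−n)X + ℓ` root-free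
mod `p` (Mazur 1978 Prop. 6.3 (1); the X10 lane's pattern `MuZeroRoad.goodOrdIrr_three_of_ainvs_of_countPoints`
at a general prime) — so a census row is `(a-invariants, p, n_p, ℓ, n)` + `decide` + the displayed
ENGINE data (`hr`/`hL`, `hcertA` / `hcert0` / `hcert1`, `hunit`, `hSch`) + the PUBLISHED binders + F1.

Binders: F1 (`hfine` — registry token `KATO04-F1-package@p`: records are LITERAL tier); PUBLISHED `hGr`,
`hS`, `hPR`, `hmodP`, `hmodL`, `hGZK`, `h5`. No BCS fact, no image hypothesis, no CM hypothesis. Per pair;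
nothing booked; not a class theorem.

References: [Kato2004Asterisque] Thm. 12.5, 12.6, 17.4, §17.13; [GreenbergLNM1716] Thm. 4.1;
[PerrinRiou1987] §1.4 Cor. 1.8; [BalakrishnanMullerStein2015] Thm. 1.7; [Mazur1978] Prop. 6.3 (1);
[IrelandRosen1990] §8.1; [Miller2011LMS] Def. 1.1; plan `OFFER-X9-KATO-EULER-v0.md`.
-/

set_option linter.dupNamespace false
set_option autoImplicit false

noncomputable section

open scoped Classical MatrixGroups ModularForm

open CongruenceSubgroup WeierstrassCurve Literature.NumberTheory.EllipticCurves
  Literature.NumberTheory.EllipticCurves.ModularForms Literature.NumberTheory.EllipticCurves.Rank1Residual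
  Literature.NumberTheory.EllipticCurves.Rank1Residual.Typed
  Literature.NumberTheory.EllipticCurves.Wuthrich2014
  Literature.NumberTheory.EllipticCurves.Kato2004
  Literature.NumberTheory.EllipticCurves.Rank1Residual.X11RankOneCertificates
  Summit.BirchSwinnertonDyer.BirchSwinnertonDyer.Rank1Residual.IntModel
  Summit.BirchSwinnertonDyer.BirchSwinnertonDyer.Rank1Residual.X11RankOne
  Summit.BirchSwinnertonDyer.BirchSwinnertonDyer.Theorems.Rank1ResidualX1Defs
  Summit.BirchSwinnertonDyer.Rank1Residual

namespace Summit.BirchSwinnertonDyer.BirchSwinnertonDyer.Rank1Residual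

variable (W : WeierstrassCurve ℚ) [W.IsElliptic] [W.IsGloballyMinimal] (p : ℕ) [Fact p.Prime]

/-! ### §1. The doors class-free and image-free -/

/-- **`μ = 0` at the pair from F1, ANY irreducible image**: `p ≥ 5` good ordinary, `E[p]` irreducible, one
unit coefficient of `L_p(f, α)` for the newform(s) of `W` at level `N_E` ⟹ `μ(X(E/ℚ_∞)) = 0` for every
cyclotomic datum. Surjective image: F1 gives Kato's Thm. 17.4 (`X10.kato_divisibility_of_fine`), whose
clause (3) applies (`ρ̄_{E,p^m}` onto for all `m` from `Surj W p`, `p ≥ 5`: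
`hasSurjectiveModNGaloisRep_pow_of_surj`): some `g ∈ char_Λ X` has `ι g = L_p(f, α)`, so `g` has unit
content by the certificate, hence so has the generator of the (principal) characteristic ideal
(`hasUnitContent_of_mem_span_singleton`), i.e. `μ = 0` (Greenberg–Vatsal (1)–(2)). Non-surjective
image: the X10/X9 kernel core `X10.mu_eq_zero_of_fine`. No BCS fact; route-cone-free.
[cite: Kato2004Asterisque, Thm. 12.5 (4), 12.6 (p. 222), Thm. 17.4 (3) (p. 273) and §17.13 (pp. 279–280)]
[cite: GreenbergVatsal2000, p. 2, (1)–(2)] -/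
theorem IrrOrd.mu_eq_zero_of_fine_of_unitCoeff (hfine : exists_divisibilityInputs_fineQuotient_zeta)
    (hmodP : nonempty_modularParametrizationData) (hp : 5 ≤ p)
    (hgood : W.HasGoodReductionAtPrime p) (hord : ¬ (p : ℤ) ∣ W.frobeniusTrace p)
    (hirr : W.HasIrreducibleModPGaloisRep p)
    (hcert : ∀ [NeZero (W.conductorNorm ℤ)] (f : CuspForm (Gamma0 (W.conductorNorm ℤ)) 2),
      IsNewformOf W f → ∃ n : ℕ, ‖PowerSeries.coeff n (padicLFunction f (unitRoot W p : ℚ_[p]))‖ = 1) :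
    ∀ (κ : ZpExtension ℚ p) (γ : Field.absoluteGaloisGroup ℚ),
      κ.IsCyclotomic → κ.IsTopGenerator γ → IsCyclotomicVariable p γ →
      ∀ D : W.SelmerDualData κ γ, D.mu = 0 := by
  intro κ γ hκ hγ hγ' D
  have hp2 : p ≠ 2 := by omega
  haveI : NeZero (W.conductorNorm ℤ) := ⟨(W.conductorNorm_pos_holds).ne'⟩
  obtain ⟨Dm⟩ := hmodP W
  by_cases hs : W.HasSurjectiveModNGaloisRep p
  · -- surjective image: Kato 17.4 (3) from F1, then `μ` drops along the divisibility
    obtain ⟨hX, -, hint⟩ := Summit.BirchSwinnertonDyer.Rank1Residual.X10.kato_divisibility_of_fine hfine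
      W p κ γ (W.conductorNorm ℤ) Dm.f hp2 ⟨hgood, hord⟩ hκ hγ hγ' Dm.isNewformOf D
    obtain ⟨g, hg, hιg⟩ := hint (hasSurjectiveModNGaloisRep_pow_of_surj hp hs)
    haveI : Module.Finite (IwasawaAlgebra p) D.X := D.module_finite_holds hγ
    haveI : (Module.charIdeal (IwasawaAlgebra p) D.X).IsPrincipal := charIdeal_isPrincipal_holds p D.X
    obtain ⟨fE, hchar⟩ := Submodule.IsPrincipal.principal (Module.charIdeal (IwasawaAlgebra p) D.X)
    have hchar' : D.charIdeal = Ideal.span {fE} := hchar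
    have hgu : GreenbergVatsal2000.HasUnitContent g :=
      (GreenbergVatsal2000.hasUnitContent_iff_exists_norm_coeff_map_eq_one g).mpr
        (hιg ▸ hcert Dm.f Dm.isNewformOf)
    exact (GreenbergVatsal2000.mu_eq_zero_iff_hasUnitContent D hX hchar').mpr
      (hasUnitContent_of_mem_span_singleton (hchar' ▸ hg) hgu)
  · exact Summit.BirchSwinnertonDyer.Rank1Residual.X10.mu_eq_zero_of_fine hfine W p Dm.f hp2 hgood hord
      hirr hs Dm.isNewformOf (hcert Dm.f Dm.isNewformOf) κ γ hκ hγ hγ' D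

/-- **Door D1, class-free: `p ≥ 5` good ordinary, `E[p]` irreducible (any image), analytic rank `≤ 1`,
`p ∤ #Ш(E/ℚ)_an`: F1 + PUBLISHED facts + certificates ⟹ Miller's `BSD(E,p)`.** Upper half from Kato
17.4 (2) + `μ = 0` (rank 0: `X10.missingUpperBoundAt_of_kato_of_greenbergMu`; rank 1: Wuthrich's cofactor
engine modulo the Schneider certificate `hSch`), lower half vacuous at `hunit`. Binders: F1; `hGr`,
`hS`, `hPR`, `hmodP`, `hmodL`, `hGZK`, `h5`; data `hr`, `hSch`, `hcertA`, `hunit`.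
[cite: Kato2004Asterisque, Thm. 17.4 (2) (p. 273)] [cite: GreenbergLNM1716, Thm. 4.1 (p. 102)]
[cite: PerrinRiou1987, §1.4 Cor. 1.8] [cite: Miller2011LMS, Def. 1.1 (arXiv:1010.2431 p. 3)] -/
theorem IrrOrd.bsdp_of_fine_of_unitCoeff_of_shaAn_unit
    (hfine : exists_divisibilityInputs_fineQuotient_zeta) (hGr : greenberg_charValue_rankZero)
    (hS : Schneider1985_order_charGenerator_odd) (hPR : perrinRiou_rankOne_leadingTerms_odd)
    (hmodP : nonempty_modularParametrizationData) (hmodL : hasEntireLFunction_rat)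
    (hGZK : rank_eq_analyticRank_of_analyticRank_le_one) (h5 : realPeriodRat_eq_unit_mul_plusPeriod)
    (hp : 5 ≤ p) (hgood : W.HasGoodReductionAtPrime p) (hord : ¬ (p : ℤ) ∣ W.frobeniusTrace p)
    (hirr : W.HasIrreducibleModPGaloisRep p) (hr : W.analyticRank ≤ 1)
    (hSch : W.analyticRank = 1 → ∀ Dh : PAdicHeightData W p, Dh.IsCanonical → SchneiderConjecture Dh)
    (hcertA : ∀ {N : ℕ} [NeZero N] (f : CuspForm (Gamma0 N) 2), IsNewformOf W f →
      ∃ n : ℕ, ‖PowerSeries.coeff n (padicLFunction f (unitRoot W p : ℚ_[p]))‖ = 1)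
    (hunit : ∃ q : ℚ, shaAn W = (q : ℂ) ∧ padicValRat p q = 0) : BSDp W p := by
  have hp2 : p ≠ 2 := by omega
  have hK : ∀ (κ : ZpExtension ℚ p) (γ : Field.absoluteGaloisGroup ℚ) [NeZero (W.conductorNorm ℤ)]
      (f : CuspForm (Gamma0 (W.conductorNorm ℤ)) 2), kato_divisibility W p (κ := κ) (γ := γ) (f := f) :=
    fun κ γ _ f ↦ Summit.BirchSwinnertonDyer.Rank1Residual.X10.kato_divisibility_of_fine hfine W p κ γ
      (W.conductorNorm ℤ) f
  have hμ := IrrOrd.mu_eq_zero_of_fine_of_unitCoeff W p hfine hmodP hp hgood hord hirr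
    (fun f hf ↦ hcertA f hf)
  have hϖ : ∀ [NeZero (W.conductorNorm ℤ)] (f : CuspForm (Gamma0 (W.conductorNorm ℤ)) 2),
      IsNewformOf W f → ∀ ϖ : ℚ, (ϖ : ℝ) * W.realPeriodRat = plusPeriod f → padicValRat p ϖ = 0 :=
    fun f hf ϖ hϖeq ↦ padicValRat_periodRatio_eq_zero_of_five_le h5 W p hp hgood hirr f hf ϖ hϖeq
  have hlow : Typed.MissingLowerBoundAt W p := by
    obtain ⟨q, hq, hv⟩ := hunit
    exact ⟨q, hq, by rw [hv]; exact_mod_cast Nat.zero_le _⟩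
  refine Typed.bsdp_of_missingPPartAt W p hGZK hr (Typed.missingPPartAt_of_lower_of_upper W p hlow ?_)
  rcases Nat.le_one_iff_eq_zero_or_eq_one.mp hr with hr0 | hr1
  · have hL : W.entireLFunction 1 ≠ 0 := (W.analyticRank_eq_zero_iff_holds (hmodL W)).1 hr0
    exact Summit.BirchSwinnertonDyer.Rank1Residual.X10.missingUpperBoundAt_of_kato_of_greenbergMu W p hGr
      hmodP hGZK hK hp2 hgood hord hirr hL hϖ hμ
  · -- rank 1: the divisibility datum into Wuthrich's cofactor engine, σ discharged
    obtain ⟨κ, hκ, γ, hγ, hγ'⟩ := exists_isCyclotomic_isTopGenerator_isCyclotomicVariable_holds p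
    obtain ⟨D⟩ := W.nonempty_selmerDualData_holds κ γ hγ
    haveI : NeZero (W.conductorNorm ℤ) := ⟨(W.conductorNorm_pos_holds).ne'⟩
    obtain ⟨Dm⟩ := hmodP W
    obtain ⟨ϖ, hϖpos, hϖeq, -⟩ := Dm.exists_rat_mul_realPeriodRat_eq_plusPeriod
    obtain ⟨Dh, hDh, -⟩ :=
      existsUnique_isCanonical_of_odd mazur_tate_sigma_exists_odd_holds W p hp2 hgood hord
    obtain ⟨hXt, g, hgmem, hιg⟩ :=
      Summit.BirchSwinnertonDyer.Rank1Residual.X10.divisibility_of_kato_of_mu_eq_zero W p (hK κ γ Dm.f)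
        hp2 hgood hord hirr hκ hγ hγ' Dm.isNewformOf D (hμ κ γ hκ hγ hγ' D) ϖ hϖpos.ne'
        (hϖ Dm.f Dm.isNewformOf ϖ hϖeq)
    obtain ⟨fE, h, s, -, -, -, -, hsha, -, hval⟩ := exists_cofactor_of_mem_charIdeal_of_rank_one_odd
      hS hPR hGZK W p hp2 hgood hord hr1 hκ hγ hγ' Dm.isNewformOf ϖ hϖeq Dh hDh (hSch hr1 Dh hDh) D hXt g
      hgmem hιg
    refine ⟨s, hsha, ?_⟩
    have h0 : 0 ≤ (((PowerSeries.constantCoeff h : ℤ_[p]) : ℚ_[p])).valuation :=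
      PadicInt.valuation_coe_nonneg
    rw [hval]
    linarith

/-- **Door D2, class-free: `p ≥ 5` good ordinary, `E[p]` irreducible (any image), ONE datum
`‖L_p(f,α)(0)‖ = 1` (⇒ rank 0): F1 + `hGr` + `hmodP` + `hGZK` + `h5` ⟹ `BSD(E,p)`** (through the
class-free `λ`-match core `OddPrime.mazurMainConjecture_of_kato_of_mu_eq_zero_of_order_le`).
[cite: Kato2004Asterisque, Thm. 17.4 (2) (p. 273)] [cite: GreenbergVatsal2000, Prop. 3.7 and p. 20]
[cite: GreenbergLNM1716, Thm. 4.1 (p. 102)] [cite: Miller2011LMS, Def. 1.1 (arXiv:1010.2431 p. 3)] -/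
theorem IrrOrd.bsdp_of_fine_of_norm_constantCoeff_eq_one
    (hfine : exists_divisibilityInputs_fineQuotient_zeta) (hGr : greenberg_charValue_rankZero)
    (hmodP : nonempty_modularParametrizationData) (hGZK : rank_eq_analyticRank_of_analyticRank_le_one)
    (h5 : realPeriodRat_eq_unit_mul_plusPeriod) (hp : 5 ≤ p) (hgood : W.HasGoodReductionAtPrime p)
    (hord : ¬ (p : ℤ) ∣ W.frobeniusTrace p) (hirr : W.HasIrreducibleModPGaloisRep p)
    (hcert0 : ∀ [NeZero (W.conductorNorm ℤ)] (f : CuspForm (Gamma0 (W.conductorNorm ℤ)) 2),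
      IsNewformOf W f → ‖PowerSeries.coeff 0 (padicLFunction f (unitRoot W p : ℚ_[p]))‖ = 1) :
    BSDp W p := by
  have hp2 : p ≠ 2 := by omega
  haveI : NeZero (W.conductorNorm ℤ) := ⟨(W.conductorNorm_pos_holds).ne'⟩
  obtain ⟨Dm⟩ := hmodP W
  have hK : ∀ (κ : ZpExtension ℚ p) (γ : Field.absoluteGaloisGroup ℚ) [NeZero (W.conductorNorm ℤ)]
      (f : CuspForm (Gamma0 (W.conductorNorm ℤ)) 2), kato_divisibility W p (κ := κ) (γ := γ) (f := f) :=
    fun κ γ _ f ↦ Summit.BirchSwinnertonDyer.Rank1Residual.X10.kato_divisibility_of_fine hfine W p κ γ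
      (W.conductorNorm ℤ) f
  have hμ := IrrOrd.mu_eq_zero_of_fine_of_unitCoeff W p hfine hmodP hp hgood hord hirr
    (fun f hf ↦ ⟨0, hcert0 f hf⟩)
  have hMC : MazurMainConjecture W p :=
    OddPrime.mazurMainConjecture_of_kato_of_mu_eq_zero_of_order_le W p hp2 hgood hord hirr
      (fun f hf ϖ hϖ ↦ padicValRat_periodRatio_eq_zero_of_five_le h5 W p hp hgood hirr f hf ϖ hϖ)
      hK hμ (fun f hf ↦ ⟨0, hcert0 f hf⟩) (X9.order_le_of_norm_constantCoeff_eq_one W p hcert0)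
  have hc0 : PowerSeries.constantCoeff (padicLFunction Dm.f (unitRoot W p : ℚ_[p])) ≠ 0 := by
    rw [← PowerSeries.coeff_zero_eq_constantCoeff_apply, ← norm_ne_zero_iff, hcert0 Dm.f Dm.isNewformOf]
    exact one_ne_zero
  have hL : W.entireLFunction 1 ≠ 0 :=
    (constantCoeff_padicLFunction_ne_zero_iff W p ⟨hgood, hord⟩ Dm.isNewformOf).mp hc0
  have hr0 : W.analyticRank = 0 :=
    (W.analyticRank_eq_zero_iff_holds Dm.isNewformOf.hasEntireLFunction).mpr hL
  exact Summit.BirchSwinnertonDyer.Rank1Residual.bsdp_of_mazurMainConjecture_of_analyticRank_eq_zero hGr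
    hmodP hGZK hp2 ⟨hgood, hord⟩ hr0 hMC

/-- **Door D3, class-free: `p ≥ 5` good ordinary, `E[p]` irreducible (any image), analytic rank 1, ONE
datum `‖[T¹]L_p(f,α)‖ = 1`: F1 + `hS` + `hPR` + `hmodP` + `hGZK` + `h5` ⟹ `BSD(E,p)`** (the coefficient is
the `μ`-certificate, the `λ`-match and — by Perrin-Riou's `p`-adic Gross–Zagier — the Schneider
certificate). [cite: Kato2004Asterisque, Thm. 17.4 (2) (p. 273)] [cite: PerrinRiou1987, §1.4 Cor. 1.8]
[cite: BalakrishnanMullerStein2015, Thm. 1.7] [cite: Miller2011LMS, Def. 1.1 (arXiv:1010.2431 p. 3)] -/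
theorem IrrOrd.bsdp_rankOne_of_fine_of_norm_coeff_one_eq_one
    (hfine : exists_divisibilityInputs_fineQuotient_zeta) (hS : Schneider1985_order_charGenerator_odd)
    (hPR : perrinRiou_rankOne_leadingTerms_odd) (hmodP : nonempty_modularParametrizationData)
    (hGZK : rank_eq_analyticRank_of_analyticRank_le_one) (h5 : realPeriodRat_eq_unit_mul_plusPeriod)
    (hp : 5 ≤ p) (hgood : W.HasGoodReductionAtPrime p) (hord : ¬ (p : ℤ) ∣ W.frobeniusTrace p)
    (hirr : W.HasIrreducibleModPGaloisRep p) (hr1 : W.analyticRank = 1)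
    (hcert1 : ∀ [NeZero (W.conductorNorm ℤ)] (f : CuspForm (Gamma0 (W.conductorNorm ℤ)) 2),
      IsNewformOf W f → ‖PowerSeries.coeff 1 (padicLFunction f (unitRoot W p : ℚ_[p]))‖ = 1) :
    BSDp W p := by
  have hp2 : p ≠ 2 := by omega
  haveI : NeZero (W.conductorNorm ℤ) := ⟨(W.conductorNorm_pos_holds).ne'⟩
  obtain ⟨Dm⟩ := hmodP W
  have hK : ∀ (κ : ZpExtension ℚ p) (γ : Field.absoluteGaloisGroup ℚ) [NeZero (W.conductorNorm ℤ)]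
      (f : CuspForm (Gamma0 (W.conductorNorm ℤ)) 2), kato_divisibility W p (κ := κ) (γ := γ) (f := f) :=
    fun κ γ _ f ↦ Summit.BirchSwinnertonDyer.Rank1Residual.X10.kato_divisibility_of_fine hfine W p κ γ
      (W.conductorNorm ℤ) f
  have hμ := IrrOrd.mu_eq_zero_of_fine_of_unitCoeff W p hfine hmodP hp hgood hord hirr
    (fun f hf ↦ ⟨1, hcert1 f hf⟩)
  have hMC : MazurMainConjecture W p :=
    OddPrime.mazurMainConjecture_of_kato_of_mu_eq_zero_of_order_le W p hp2 hgood hord hirr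
      (fun f hf ϖ hϖ ↦ padicValRat_periodRatio_eq_zero_of_five_le h5 W p hp hgood hirr f hf ϖ hϖ)
      hK hμ (fun f hf ↦ ⟨1, hcert1 f hf⟩)
      (OddPrime.order_le_of_rankOne_of_norm_coeff_one_eq_one W p hp2 hgood hord hS hGZK hK hr1 hcert1)
  have hSch : ∀ Dh : PAdicHeightData W p, Dh.IsCanonical → SchneiderConjecture Dh := by
    intro Dh hDh
    refine (coeff_one_padicLFunction_ne_zero_iff_schneider_odd hPR hGZK W p hp2 ⟨hgood, hord⟩ hr1 Dh hDh
      Dm.f Dm.isNewformOf).mp ?_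
    rw [← norm_ne_zero_iff, hcert1 Dm.f Dm.isNewformOf]
    exact one_ne_zero
  exact Summit.BirchSwinnertonDyer.Rank1Residual.bsdp_of_mazurMainConjecture_of_analyticRank_eq_one_of_schneider_odd
    hS hPR mazur_tate_sigma_exists_odd_holds hmodP hGZK hp2 ⟨hgood, hord⟩ hr1 hSch hMC

/-! ### §2. Record shapes: reduction, ordinarity, irreducibility decided from a literal integer model -/

namespace Record

/-- Good reduction at `p`, ordinarity and irreducibility of `E[p]` read off a literal integer model by
kernel-decidable data: `p ∤ Δ`; the schema count `countPoints [a₁,…,a₆] p = n_p` (`= #Ẽ(𝔽_p)`,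
`X11b.natCard_point_eq_countPoints`) with `p ∤ p + 1 − n_p`; a Frobenius witness `ℓ ≠ 2, p`, `ℓ ∤ Δ`,
`countPoints [a₁,…,a₆] ℓ = n` with `X² − (ℓ+1−n)X + ℓ` root-free mod `p` (Mazur 1978 Prop. 6.3 (1),
`hasIrreducibleModPGaloisRep_of_intModel_of_noroot`). The X10 lane's
`MuZeroRoad.goodOrdIrr_three_of_ainvs_of_countPoints` at a general odd prime.
[cite: Mazur1978, §6 Prop. 6.3 (1) (p. 153)] [cite: IrelandRosen1990, Prop. 5.1.2 and §8.1] -/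
theorem goodOrdIrr_of_ainvs_of_countPoints (a1 a2 a3 a4 a6 : ℤ) {W : WeierstrassCurve ℚ}
    [W.IsElliptic] [W.IsGloballyMinimal] (hW : integralModelInt W = ⟨a1, a2, a3, a4, a6⟩)
    (p : ℕ) [Fact p.Prime] (hp2 : p ≠ 2) (ℓ n np : ℕ) [Fact ℓ.Prime]
    (hpΔ : ¬ (p : ℤ) ∣ discOf [a1, a2, a3, a4, a6])
    (hcp : countPoints [a1, a2, a3, a4, a6] p = np) (hordp : ¬ (p : ℤ) ∣ (p : ℤ) + 1 - np)
    (hℓ2 : ℓ ≠ 2) (hℓp : ℓ ≠ p) (hℓΔ : ¬ (ℓ : ℤ) ∣ discOf [a1, a2, a3, a4, a6])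
    (hc : countPoints [a1, a2, a3, a4, a6] ℓ = n)
    (hnoroot : ∀ t : ℕ, t < p → ¬ (p : ℤ) ∣ (t : ℤ) ^ 2 - ((ℓ : ℤ) + 1 - n) * t + ℓ) :
    W.HasGoodReductionAtPrime p ∧ ¬ (p : ℤ) ∣ W.frobeniusTrace p ∧ W.HasIrreducibleModPGaloisRep p := by
  have hΔ : (⟨a1, a2, a3, a4, a6⟩ : WeierstrassCurve ℤ).Δ = discOf [a1, a2, a3, a4, a6] :=
    intCurve_Δ a1 a2 a3 a4 a6
  have hcardp : Nat.card (((⟨a1, a2, a3, a4, a6⟩ : WeierstrassCurve ℤ).map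
      (Int.castRingHom (ZMod p))).toAffine.Point) = np := by
    have h := X11b.natCard_point_eq_countPoints a1 a2 a3 a4 a6 p hp2 (by rw [hΔ]; exact hpΔ)
    rw [hcp] at h
    exact_mod_cast h
  have hcard : Nat.card (((⟨a1, a2, a3, a4, a6⟩ : WeierstrassCurve ℤ).map
      (Int.castRingHom (ZMod ℓ))).toAffine.Point) = n := by
    have h := X11b.natCard_point_eq_countPoints a1 a2 a3 a4 a6 ℓ hℓ2 (by rw [hΔ]; exact hℓΔ)
    rw [hc] at h
    exact_mod_cast h
  have hgood : W.HasGoodReductionAtPrime p :=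
    hasGoodReductionAtPrime_of_not_dvd W p (by rw [minimalDiscriminantInt_eq hW, hΔ]; exact hpΔ)
  have hord : ¬ (p : ℤ) ∣ W.frobeniusTrace p := by
    rw [frobeniusTrace_eq hW hcardp]; exact hordp
  haveI : NeZero p := ⟨(Fact.out : p.Prime).ne_zero⟩
  have hirr : W.HasIrreducibleModPGaloisRep p := by
    refine hasIrreducibleModPGaloisRep_of_intModel_of_noroot hW p ℓ hℓp (by rw [hΔ]; exact hℓΔ) hcard
      (forall_zmod_of_forall_lt fun t ht h0 ↦ hnoroot t ht ?_)
    rw [← ZMod.intCast_zmod_eq_zero_iff_dvd]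
    push_cast at h0 ⊢
    linear_combination h0
  exact ⟨hgood, hord, hirr⟩

/-- **RECORD shape of door D1** (`IrrOrd.bsdp_of_fine_of_unitCoeff_of_shaAn_unit` read off a literal
integer model `[a₁,…,a₆]` with the `decide`-able certificates of `goodOrdIrr_of_ainvs_of_countPoints`, the
census data `hr` / `hSch` / `hcertA` / `hunit` displayed, `5 ≤ p`). Per pair; F1 ⇒ LITERAL tier.
[cite: Kato2004Asterisque, Thm. 17.4 (2) (p. 273)] [cite: Mazur1978, §6 Prop. 6.3 (1) (p. 153)]
[cite: Miller2011LMS, Def. 1.1 (arXiv:1010.2431 p. 3)] -/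
theorem bsdp_of_ainvs_of_fine_of_unitCoeff_of_shaAn_unit
    (hfine : exists_divisibilityInputs_fineQuotient_zeta) (hGr : greenberg_charValue_rankZero)
    (hS : Schneider1985_order_charGenerator_odd) (hPR : perrinRiou_rankOne_leadingTerms_odd)
    (hmodP : nonempty_modularParametrizationData) (hmodL : hasEntireLFunction_rat)
    (hGZK : rank_eq_analyticRank_of_analyticRank_le_one) (h5 : realPeriodRat_eq_unit_mul_plusPeriod)
    (a1 a2 a3 a4 a6 : ℤ) {W : WeierstrassCurve ℚ} [W.IsElliptic] [W.IsGloballyMinimal]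
    (hW : integralModelInt W = ⟨a1, a2, a3, a4, a6⟩) (p : ℕ) [Fact p.Prime] (hp : 5 ≤ p)
    (ℓ n np : ℕ) [Fact ℓ.Prime] (hpΔ : ¬ (p : ℤ) ∣ discOf [a1, a2, a3, a4, a6])
    (hcp : countPoints [a1, a2, a3, a4, a6] p = np) (hordp : ¬ (p : ℤ) ∣ (p : ℤ) + 1 - np)
    (hℓ2 : ℓ ≠ 2) (hℓp : ℓ ≠ p) (hℓΔ : ¬ (ℓ : ℤ) ∣ discOf [a1, a2, a3, a4, a6])
    (hc : countPoints [a1, a2, a3, a4, a6] ℓ = n)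
    (hnoroot : ∀ t : ℕ, t < p → ¬ (p : ℤ) ∣ (t : ℤ) ^ 2 - ((ℓ : ℤ) + 1 - n) * t + ℓ)
    (hr : W.analyticRank ≤ 1)
    (hSch : W.analyticRank = 1 → ∀ Dh : PAdicHeightData W p, Dh.IsCanonical → SchneiderConjecture Dh)
    (hcertA : ∀ {N : ℕ} [NeZero N] (f : CuspForm (Gamma0 N) 2), IsNewformOf W f →
      ∃ m : ℕ, ‖PowerSeries.coeff m (padicLFunction f (unitRoot W p : ℚ_[p]))‖ = 1)
    (hunit : ∃ q : ℚ, shaAn W = (q : ℂ) ∧ padicValRat p q = 0) : BSDp W p := by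
  obtain ⟨hgood, hord, hirr⟩ := goodOrdIrr_of_ainvs_of_countPoints a1 a2 a3 a4 a6 hW p (by omega) ℓ n
    np hpΔ hcp hordp hℓ2 hℓp hℓΔ hc hnoroot
  exact IrrOrd.bsdp_of_fine_of_unitCoeff_of_shaAn_unit W p hfine hGr hS hPR hmodP hmodL hGZK h5 hp hgood
    hord hirr hr hSch hcertA hunit

/-- **RECORD shape of door D2** (rank-0 unit cell, ONE datum `‖L_p(f,α)(0)‖ = 1`, read off a literal
integer model). Per pair; F1 ⇒ LITERAL tier. [cite: Kato2004Asterisque, Thm. 17.4 (2) (p. 273)]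
[cite: Mazur1978, §6 Prop. 6.3 (1) (p. 153)] [cite: Miller2011LMS, Def. 1.1 (arXiv:1010.2431 p. 3)] -/
theorem bsdp_of_ainvs_of_fine_of_norm_constantCoeff_eq_one
    (hfine : exists_divisibilityInputs_fineQuotient_zeta) (hGr : greenberg_charValue_rankZero)
    (hmodP : nonempty_modularParametrizationData) (hGZK : rank_eq_analyticRank_of_analyticRank_le_one)
    (h5 : realPeriodRat_eq_unit_mul_plusPeriod)
    (a1 a2 a3 a4 a6 : ℤ) {W : WeierstrassCurve ℚ} [W.IsElliptic] [W.IsGloballyMinimal]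
    (hW : integralModelInt W = ⟨a1, a2, a3, a4, a6⟩) (p : ℕ) [Fact p.Prime] (hp : 5 ≤ p)
    (ℓ n np : ℕ) [Fact ℓ.Prime] (hpΔ : ¬ (p : ℤ) ∣ discOf [a1, a2, a3, a4, a6])
    (hcp : countPoints [a1, a2, a3, a4, a6] p = np) (hordp : ¬ (p : ℤ) ∣ (p : ℤ) + 1 - np)
    (hℓ2 : ℓ ≠ 2) (hℓp : ℓ ≠ p) (hℓΔ : ¬ (ℓ : ℤ) ∣ discOf [a1, a2, a3, a4, a6])
    (hc : countPoints [a1, a2, a3, a4, a6] ℓ = n)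
    (hnoroot : ∀ t : ℕ, t < p → ¬ (p : ℤ) ∣ (t : ℤ) ^ 2 - ((ℓ : ℤ) + 1 - n) * t + ℓ)
    (hcert0 : ∀ [NeZero (W.conductorNorm ℤ)] (f : CuspForm (Gamma0 (W.conductorNorm ℤ)) 2),
      IsNewformOf W f → ‖PowerSeries.coeff 0 (padicLFunction f (unitRoot W p : ℚ_[p]))‖ = 1) :
    BSDp W p := by
  obtain ⟨hgood, hord, hirr⟩ := goodOrdIrr_of_ainvs_of_countPoints a1 a2 a3 a4 a6 hW p (by omega) ℓ n
    np hpΔ hcp hordp hℓ2 hℓp hℓΔ hc hnoroot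
  exact IrrOrd.bsdp_of_fine_of_norm_constantCoeff_eq_one W p hfine hGr hmodP hGZK h5 hp hgood hord hirr
    hcert0

/-- **RECORD shape of door D3** (rank 1, ONE datum `‖[T¹]L_p(f,α)‖ = 1`, read off a literal integer
model; `hr1` the census rank). Per pair; F1 ⇒ LITERAL tier. [cite: Kato2004Asterisque, Thm. 17.4 (2) (p. 273)]
[cite: PerrinRiou1987, §1.4 Cor. 1.8] [cite: Mazur1978, §6 Prop. 6.3 (1) (p. 153)]
[cite: Miller2011LMS, Def. 1.1 (arXiv:1010.2431 p. 3)] -/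
theorem bsdp_rankOne_of_ainvs_of_fine_of_norm_coeff_one_eq_one
    (hfine : exists_divisibilityInputs_fineQuotient_zeta) (hS : Schneider1985_order_charGenerator_odd)
    (hPR : perrinRiou_rankOne_leadingTerms_odd) (hmodP : nonempty_modularParametrizationData)
    (hGZK : rank_eq_analyticRank_of_analyticRank_le_one) (h5 : realPeriodRat_eq_unit_mul_plusPeriod)
    (a1 a2 a3 a4 a6 : ℤ) {W : WeierstrassCurve ℚ} [W.IsElliptic] [W.IsGloballyMinimal]
    (hW : integralModelInt W = ⟨a1, a2, a3, a4, a6⟩) (p : ℕ) [Fact p.Prime] (hp : 5 ≤ p)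
    (ℓ n np : ℕ) [Fact ℓ.Prime] (hpΔ : ¬ (p : ℤ) ∣ discOf [a1, a2, a3, a4, a6])
    (hcp : countPoints [a1, a2, a3, a4, a6] p = np) (hordp : ¬ (p : ℤ) ∣ (p : ℤ) + 1 - np)
    (hℓ2 : ℓ ≠ 2) (hℓp : ℓ ≠ p) (hℓΔ : ¬ (ℓ : ℤ) ∣ discOf [a1, a2, a3, a4, a6])
    (hc : countPoints [a1, a2, a3, a4, a6] ℓ = n)
    (hnoroot : ∀ t : ℕ, t < p → ¬ (p : ℤ) ∣ (t : ℤ) ^ 2 - ((ℓ : ℤ) + 1 - n) * t + ℓ)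
    (hr1 : W.analyticRank = 1)
    (hcert1 : ∀ [NeZero (W.conductorNorm ℤ)] (f : CuspForm (Gamma0 (W.conductorNorm ℤ)) 2),
      IsNewformOf W f → ‖PowerSeries.coeff 1 (padicLFunction f (unitRoot W p : ℚ_[p]))‖ = 1) :
    BSDp W p := by
  obtain ⟨hgood, hord, hirr⟩ := goodOrdIrr_of_ainvs_of_countPoints a1 a2 a3 a4 a6 hW p (by omega) ℓ n
    np hpΔ hcp hordp hℓ2 hℓp hℓΔ hc hnoroot
  exact IrrOrd.bsdp_rankOne_of_fine_of_norm_coeff_one_eq_one W p hfine hS hPR hmodP hGZK h5 hp hgood hord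
    hirr hr1 hcert1

end Record

end Summit.BirchSwinnertonDyer.BirchSwinnertonDyer.Rank1Residual

end
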